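import Literature.NumberTheory.Automorphic.GL2CasimirScalar
import Literature.NumberTheory.Automorphic.HarishChandraGLParameterOfCharacter
import HarnessLib

/-!
# The Harish-Chandra parameter of a `𝔤𝔩₂(ℝ)`-module from its Casimir and central scalars

Topic `NumberTheory/Automorphic`; theorems only (no definition, no named fact; D-0026), the
**converse** of the computation of `GL2CasimirScalar` (there: parameter `{s₁, s₂}` ⟹ the Casimir
element `C = ∑ E_{ab}E_{ba}` acts by `s₁² + s₂² - ½` and `Z = E₁₁ + E₂₂` by `s₁ + s₂`). Here: if
`Z(𝔤𝔩₂(ℝ))` acts on `V` through some character (`HasCentralCharacter`, e.g. by Schur's lemma for an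
irreducible admissible `(𝔤, K)`-module) and `C v = (s₁² + s₂² - ½) v`, `Z v = (s₁ + s₂) v` for ONE
non-zero `v ∈ V`, then `V` has Harish-Chandra parameter `{s₁, s₂}` (`HasHCParameter`). Indeed by
`exists_hasHCParameter_of_hasCentralCharacter` (Harish-Chandra's isomorphism, proved in the tree)
`V` has some parameter `{t₁, t₂}`, on which `C`, `Z` act by `t₁² + t₂² - ½`, `t₁ + t₂`
(`GL2Casimir.lift_casimir_eq_of_hasHCParameter`, `lift_zed_eq_of_hasHCParameter`); comparing on `v`
gives `t₁ + t₂ = s₁ + s₂`, `t₁ t₂ = s₁ s₂`, i.e. `{t₁, t₂} = {s₁, s₂}`. This is the step that reads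
the archimedean component of the automorphic representation generated by a holomorphic (or Maass)
form off the eigenvalues of the Casimir/Laplace operator and of the centre (Bump 1997, §2.2;
Gelbart 1975, §4; Knapp 2002, Thm. 5.44 with Prop. 5.32), used by the dictionary
"eigenform of weight `k` ↦ regular algebraic `π`" (parameter `{(k-1)/2, (1-k)/2}` from
`C = (k-1)²/2 - ½`, `Z = 0` on the unitary lift).

* `GL2Casimir.pair_eq_pair_of_add_eq_of_mul_eq` — `{t₁, t₂} = {s₁, s₂}` from equal sum and product;
* `GL2Casimir.hasHCParameter_of_lift_casimir_of_lift_zed` — the statement with `C`, `Z` as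
  elements of `U(𝔤𝔩₂(ℝ))` acting through `UniversalEnvelopingAlgebra.lift`;
* `GL2Casimir.hasHCParameter_of_sum_rho_single_of_rho_one` — the same with
  `C v = ∑_{a,b} ρ(E_{ab}) ρ(E_{ba}) v` and `Z v = ρ(1) v` spelled out.

## References

* A. W. Knapp, *Lie Groups Beyond an Introduction*, 2nd ed. (2002), §V.4–V.5, Prop. 5.32,
  Thm. 5.44. [Knapp2002]
* D. Bump, *Automorphic Forms and Representations* (1997), §2.2. [Bump1997]
-/

noncomputable section

-- Mathlib idiom (Mathlib/Algebra/Lie/OfAssociative.lean), as in `GL2CasimirScalar` and `HarishChandraGL`: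
-- the Lie bracket on `Matrix (Fin 2) (Fin 2) ℝ` used by `HasHCParameter` is the commutator.
attribute [local instance 100] LieRing.ofAssociativeRing

open UniversalEnvelopingAlgebra

namespace Literature.NumberTheory.Automorphic

namespace GL2Casimir

open GLnCasimir HCSpan

variable {V : Type*} [AddCommGroup V] [Module ℂ V] {ρ : Matrix (Fin 2) (Fin 2) ℝ →ₗ⁅ℝ⁆ Module.End ℂ V}

/-- Two numbers with the same sum and product as `s₁, s₂` are `s₁, s₂` as a multiset. [folklore] -/
theorem pair_eq_pair_of_add_eq_of_mul_eq {t₁ t₂ s₁ s₂ : ℂ} (hadd : t₁ + t₂ = s₁ + s₂)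
    (hmul : t₁ * t₂ = s₁ * s₂) : ({t₁, t₂} : Multiset ℂ) = {s₁, s₂} := by
  have key : (t₁ - s₁) * (t₁ - s₂) = 0 := by linear_combination t₁ * hadd - hmul
  rcases mul_eq_zero.mp key with h | h
  · have h1 : t₁ = s₁ := sub_eq_zero.mp h
    have h2 : t₂ = s₂ := by linear_combination hadd - h1
    rw [h1, h2]
  · have h1 : t₁ = s₂ := sub_eq_zero.mp h
    have h2 : t₂ = s₁ := by linear_combination hadd - h1
    rw [h1, h2, Multiset.pair_comm]

/-- **The Harish-Chandra parameter of a `𝔤𝔩₂(ℝ)`-module from the Casimir and central scalars on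
one vector.** If `Z(𝔤𝔩₂(ℝ))` acts on `V` through a character `θ` and for some `v ≠ 0` the
Casimir element `C` and the centre `Z = ι(1)` of `U(𝔤𝔩₂(ℝ))` act by `C v = (s₁² + s₂² - ½) v`,
`Z v = (s₁ + s₂) v`, then `V` has Harish-Chandra parameter `{s₁, s₂}`: `V` has some parameter
`{t₁, t₂}` (`exists_hasHCParameter_of_hasCentralCharacter`), on which `C`, `Z` act by
`t₁² + t₂² - ½`, `t₁ + t₂` (`lift_casimir_eq_of_hasHCParameter`, `lift_zed_eq_of_hasHCParameter`),
so `t₁ + t₂ = s₁ + s₂` and `t₁ t₂ = s₁ s₂`. Knapp 2002, Thm. 5.44 with Prop. 5.32; Bump 1997, §2.2.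
[cite: Knapp2002, §V.5 Thm. 5.44 and Prop. 5.32] -/
theorem hasHCParameter_of_lift_casimir_of_lift_zed
    {θ : Subalgebra.center ℝ (UniversalEnvelopingAlgebra ℝ (Matrix (Fin 2) (Fin 2) ℝ)) →ₐ[ℝ] ℂ}
    (hθ : HasCentralCharacter ρ θ) {v : V} (hv : v ≠ 0) {s₁ s₂ : ℂ}
    (hC : lift ℝ ρ (casimir 2) v = (s₁ ^ 2 + s₂ ^ 2 - 1 / 2) • v)
    (hZ : lift ℝ ρ (zed 2) v = (s₁ + s₂) • v) :
    HasHCParameter ρ fun _ => ({s₁, s₂} : Multiset ℂ) := by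
  obtain ⟨χ, hχ⟩ := exists_hasHCParameter_of_hasCentralCharacter ρ hθ
  let τ₀ : ℝ →ₐ[ℝ] ℂ := Algebra.ofId ℝ ℂ
  obtain ⟨t₁, t₂, ht⟩ : ∃ t₁ t₂, χ τ₀ = {t₁, t₂} :=
    Multiset.card_eq_two.mp (card_eq_of_hasHCParameter ρ hχ τ₀)
  have hχ' : χ = fun _ => ({t₁, t₂} : Multiset ℂ) := by
    funext τ
    rw [Subsingleton.elim τ τ₀, ht]
  rw [hχ'] at hχ
  -- compare the two scalars on `v`
  have hC' := congrArg (fun T : Module.End ℂ V => T v) (lift_casimir_eq_of_hasHCParameter hχ)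
  have hZ' := congrArg (fun T : Module.End ℂ V => T v) (lift_zed_eq_of_hasHCParameter hχ)
  simp only [Module.algebraMap_end_apply] at hC' hZ'
  rw [hC] at hC'
  rw [hZ] at hZ'
  have hsmul : ∀ {a b : ℂ}, a • v = b • v → a = b := fun {a b} h => by
    have h' : (a - b) • v = 0 := by rw [sub_smul, h, sub_self]
    exact sub_eq_zero.mp ((smul_eq_zero.mp h').resolve_right hv)
  have e1 : s₁ + s₂ = t₁ + t₂ := hsmul hZ'
  have e2 : s₁ ^ 2 + s₂ ^ 2 - 1 / 2 = t₁ ^ 2 + t₂ ^ 2 - 1 / 2 := hsmul hC'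
  have hmul : t₁ * t₂ = s₁ * s₂ := by
    linear_combination (-(1 / 2 : ℂ)) * (s₁ + s₂ + t₁ + t₂) * e1 + (1 / 2 : ℂ) * e2
  rw [← pair_eq_pair_of_add_eq_of_mul_eq e1.symm hmul]
  exact hχ

/-- **Applied form.** As `hasHCParameter_of_lift_casimir_of_lift_zed`, with the Casimir and the
centre spelled out on the vector: `∑_{a,b} ρ(E_{ab}) ρ(E_{ba}) v = (s₁² + s₂² - ½) v` and
`ρ(1) v = (s₁ + s₂) v` (cf. `sum_rho_single_apply_of_hasHCParameter`,
`rho_one_apply_of_hasHCParameter` for the converse). [cite: Knapp2002, §V.5 Thm. 5.44 and Prop. 5.32] -/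
theorem hasHCParameter_of_sum_rho_single_of_rho_one
    {θ : Subalgebra.center ℝ (UniversalEnvelopingAlgebra ℝ (Matrix (Fin 2) (Fin 2) ℝ)) →ₐ[ℝ] ℂ}
    (hθ : HasCentralCharacter ρ θ) {v : V} (hv : v ≠ 0) {s₁ s₂ : ℂ}
    (hC : (∑ a : Fin 2, ∑ b : Fin 2,
        ρ (Matrix.single a b (1 : ℝ)) (ρ (Matrix.single b a (1 : ℝ)) v)) =
      (s₁ ^ 2 + s₂ ^ 2 - 1 / 2) • v)
    (hZ : ρ (1 : Matrix (Fin 2) (Fin 2) ℝ) v = (s₁ + s₂) • v) :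
    HasHCParameter ρ fun _ => ({s₁, s₂} : Multiset ℂ) := by
  refine hasHCParameter_of_lift_casimir_of_lift_zed hθ hv ?_ ?_
  · rw [casimir_eq_sum]
    simpa only [map_sum, LinearMap.sum_apply, lift_ιU_mul_ιU_apply] using hC
  · change lift ℝ ρ (ι ℝ (1 : Matrix (Fin 2) (Fin 2) ℝ)) v = _
    rw [lift_ι_apply]
    exact hZ

end GL2Casimir

end Literature.NumberTheory.Automorphic
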